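import Summits.KontsevichZagierPeriods.KontsevichZagierPeriods.Theorems.UnfoldedLogStokes.Negative.Kit

/-!
# `LiouvilleUnfolding.UnfoldedLogStokes` (stmt-KontsevichZagierPeriods-2835) — load-bearing hypotheses I

ANY proof of the crux `UnfoldedLogStokes` (route KontsevichZagierPeriods/LiouvilleUnfolding; the crux is
TRUE, candidate proof attached to the item) must use: `a ≤ b` on the base
(`unfoldedLogStokes_false_without_hab` — witness A: `a = 1 > 0 = b`, the band is EMPTY but the boundary
term `[{1 ≤ u ≤ V(a)}, H(a)/u] = log 2` survives, exactly the printed soundness caveat of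
`KZ.newtonLeibnizRel`); `1 ≤ V` on the band, which can NOT be weakened to `0 < V` (`not_posV` — witness
B: `V = (1+t)/2`, the honest domain `{1 ≤ u ≤ V}` computes `log⁺ V`, not `log V`); continuity of
`t ↦ V (x,t)` on the CLOSED fibre (`unfoldedLogStokes_false_without_contV` — witness C: a semialgebraic
step of `V` at `t = b`; the boundary term reads the endpoint VALUE, the bulk reads the interior).
Method: honest one-variable representations over `ℝ⁰` (kit `Negative/Kit.lean`) whose values do not
cancel; soundness `KZ.relations_le_ker_eval_holds` forbids the conclusion.  Part II
(`Negative/LoadBearingII.lean`): continuity of `H`, the two `HasDerivAt` clauses.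
[Kontsevich–Zagier 2001, §1.2] [folklore]
-/

noncomputable section

open Set MeasureTheory MvPolynomial Filter Topology
open Literature.NumberTheory.Transcendental Literature.ModelTheory.ExponentialFields
open Literature.NumberTheory.Transcendental.SemialgebraicDerivative (sa_atom)
open Summit.KontsevichZagierPeriods.KontsevichZagierPeriods.Theses.LiouvilleUnfolding (UnfoldedLogStokes)

namespace Summit.KontsevichZagierPeriods.LiouvilleUnfolding.UnfoldedLogStokesNegative

/-! ### Shared boundary values and the derivative of a step -/

/-- A constant `V` at an endpoint. [folklore] -/
theorem const_snoc (c d : ℝ) : ∀ x : Fin 0 → ℝ, (fun _ : Fin 1 → ℝ => d) (Fin.snoc x c) = d :=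
  fun _ => rfl
/-- `V = 1 + t` at `t = 1` is `2`. [folklore] -/
theorem Vlin_snoc_one : ∀ x : Fin 0 → ℝ, Vlin (Fin.snoc x 1) = 2 := fun x => by norm_num
/-- `V = 1 + t` at `t = 0` is `1`. [folklore] -/
theorem Vlin_snoc_zero : ∀ x : Fin 0 → ℝ, Vlin (Fin.snoc x 0) = 1 := fun x => by simp
/-- `V = (1+t)/2` at `t = 1` is `1`. [folklore] -/
theorem Vhalf_snoc_one : ∀ x : Fin 0 → ℝ, Vhalf (Fin.snoc x 1) = 1 := fun x => by norm_num
/-- `V = (1+t)/2` at `t = 0` is `1/2`. [folklore] -/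
theorem Vhalf_snoc_zero : ∀ x : Fin 0 → ℝ, Vhalf (Fin.snoc x 0) = 1 / 2 := fun x => by simp
/-- A step at `t = 1` takes its upper value. [folklore] -/
theorem step_snoc_one (c₁ c₂ : ℝ) : ∀ x : Fin 0 → ℝ, step c₁ c₂ (Fin.snoc x 1) = c₂ :=
  fun x => step_of_not_lt (by simp)
/-- A step at `t = 0` takes its lower value. [folklore] -/
theorem step_snoc_zero (c₁ c₂ : ℝ) : ∀ x : Fin 0 → ℝ, step c₁ c₂ (Fin.snoc x 0) = c₁ :=
  fun x => step_of_lt (by simp)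

/-- The constant `1/2` is semialgebraic. [folklore] -/
theorem sa_half : IsSemialgebraicFunOn ℚ τ₀ (fun _ => (1 / 2 : ℝ)) := by
  simpa using isSemialgebraicFunOn_ratCast sa_τ₀ (1 / 2)

/-- Off the jump, a step is locally constant: derivative `0` at every `t < 1`. -/
theorem hasDerivAt_step (c₁ c₂ : ℝ) {t : ℝ} (ht : t < 1) (x : Fin 0 → ℝ) :
    HasDerivAt (fun s : ℝ => step c₁ c₂ (Fin.snoc x s)) 0 t := by
  refine (hasDerivAt_const t c₁).congr_of_eventuallyEq ?_
  filter_upwards [Iio_mem_nhds ht] with s hs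
  exact step_of_lt (by simpa using hs)

/-- `t ↦ 1 + t` has derivative `1`. [folklore] -/
theorem hasDerivAt_Vlin (t : ℝ) (x : Fin 0 → ℝ) :
    HasDerivAt (fun s : ℝ => Vlin (Fin.snoc x s)) 1 t := by
  simp only [Vlin_apply, snoc_fin0]
  exact (hasDerivAt_id' t).const_add 1

/-- `t ↦ (1+t)/2` has derivative `1/2`. [folklore] -/
theorem hasDerivAt_Vhalf (t : ℝ) (x : Fin 0 → ℝ) :
    HasDerivAt (fun s : ℝ => Vhalf (Fin.snoc x s)) (1 / 2) t := by
  simp only [Vhalf_apply, snoc_fin0]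
  exact ((hasDerivAt_id' t).const_add 1).div_const 2

/-- `t ↦ 1 + t` is continuous. [folklore] -/
theorem continuousOn_Vlin (x : Fin 0 → ℝ) (s : Set ℝ) :
    ContinuousOn (fun t : ℝ => Vlin (Fin.snoc x t)) s := by
  simp only [Vlin_apply, snoc_fin0]
  exact (continuousOn_const.add continuousOn_id)

/-- `t ↦ (1+t)/2` is continuous. [folklore] -/
theorem continuousOn_Vhalf (x : Fin 0 → ℝ) (s : Set ℝ) :
    ContinuousOn (fun t : ℝ => Vhalf (Fin.snoc x t)) s := by
  simp only [Vhalf_apply, snoc_fin0]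
  exact (continuousOn_const.add continuousOn_id).div_const _

/-- `t ↦ t` is continuous. [folklore] -/
theorem continuousOn_Hcoord (x : Fin 0 → ℝ) (s : Set ℝ) :
    ContinuousOn (fun t : ℝ => Hcoord (Fin.snoc x t)) s := by
  simp only [Hcoord_apply, snoc_fin0]
  exact continuousOn_id

/-! ## §2 Load-bearing analysis: every ANALYTIC hypothesis of the crux is necessary

Method: delete one hypothesis, keep all others honest, and exhibit honest representations whose
values do not cancel; soundness (`KZ.relations_le_ker_eval_holds`) then forbids the conclusion.
The SEMIALGEBRAICITY hypotheses (`τ, a, b, H, V`) cannot be tested this way: deleting them keeps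
`eval = 0` (they are not needed for soundness, only for the intermediate representations of a
derivation) — see §4. -/

/-! ### §2a `a ≤ b` is load-bearing
Witness A: `n = 0`, `a = 1 > 0 = b` (empty band), `H = t`, `H' = 1`, `V = 2`, `V' = 0`.  The band
terms `r₁, r₄` have empty domains, `r₂ = [[1,2], H(b)/u] = [[1,2], 0]`, but
`r₃ = [[1,2], H(a)/u] = [[1,2], 1/u]` has value `log 2 > 0`: the combination evaluates to `log 2`. -/

/-- The crux with the hypothesis `∀ x ∈ τ, a x ≤ b x` DELETED. -/
def WithoutHab : Prop :=
  ∀ (n : ℕ) (τ : Set (Fin n → ℝ)) (a b : (Fin n → ℝ) → ℝ) (H H' V V' : (Fin (n + 1) → ℝ) → ℝ) (r₁ : Literature.NumberTheory.Transcendental.KZ.IntegralRep (n + 2)) (r₂ r₃ r₄ : Literature.NumberTheory.Transcendental.KZ.IntegralRep (n + 1)), Literature.ModelTheory.ExponentialFields.IsSemialgebraic ℚ τ →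
    Literature.NumberTheory.Transcendental.IsSemialgebraicFunOn ℚ τ a →
    Literature.NumberTheory.Transcendental.IsSemialgebraicFunOn ℚ τ b →
    r₄.domain = {z | (Fin.init z : Fin n → ℝ) ∈ τ ∧ a (Fin.init z) ≤ z (Fin.last n) ∧ z (Fin.last n) ≤ b (Fin.init z)} →
    Literature.NumberTheory.Transcendental.IsSemialgebraicFunOn ℚ r₄.domain H →
    Literature.NumberTheory.Transcendental.IsSemialgebraicFunOn ℚ r₄.domain V →
    (∀ z ∈ r₄.domain, 1 ≤ V z) →
    (∀ x ∈ τ, ContinuousOn (fun t : ℝ => H (Fin.snoc x t)) (Set.Icc (a x) (b x)) ∧ ContinuousOn (fun t : ℝ => V (Fin.snoc x t)) (Set.Icc (a x) (b x))) →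
    (∀ x ∈ τ, ∀ t ∈ Set.Ioo (a x) (b x), HasDerivAt (fun s : ℝ => H (Fin.snoc x s)) (H' (Fin.snoc x t)) t ∧ HasDerivAt (fun s : ℝ => V (Fin.snoc x s)) (V' (Fin.snoc x t)) t) →
    (∀ z ∈ r₄.domain, a (Fin.init z) < z (Fin.last n) → z (Fin.last n) < b (Fin.init z) → r₄.integrand z = H z * V' z / V z) →
    r₁.domain = {w | (Fin.init w : Fin (n + 1) → ℝ) ∈ r₄.domain ∧ 1 ≤ w (Fin.last (n + 1)) ∧ w (Fin.last (n + 1)) ≤ V (Fin.init w)} →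
    (∀ w ∈ r₁.domain, a (Fin.init (Fin.init w)) < Fin.init w (Fin.last n) → Fin.init w (Fin.last n) < b (Fin.init (Fin.init w)) → r₁.integrand w = H' (Fin.init w) / w (Fin.last (n + 1))) →
    r₂.domain = {z | (Fin.init z : Fin n → ℝ) ∈ τ ∧ 1 ≤ z (Fin.last n) ∧ z (Fin.last n) ≤ V (Fin.snoc (Fin.init z) (b (Fin.init z)))} →
    (∀ z ∈ r₂.domain, r₂.integrand z = H (Fin.snoc (Fin.init z) (b (Fin.init z))) / z (Fin.last n)) →
    r₃.domain = {z | (Fin.init z : Fin n → ℝ) ∈ τ ∧ 1 ≤ z (Fin.last n) ∧ z (Fin.last n) ≤ V (Fin.snoc (Fin.init z) (a (Fin.init z)))} →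
    (∀ z ∈ r₃.domain, r₃.integrand z = H (Fin.snoc (Fin.init z) (a (Fin.init z))) / z (Fin.last n)) →
    Literature.NumberTheory.Transcendental.KZ.of r₁ - Literature.NumberTheory.Transcendental.KZ.of r₂ + Literature.NumberTheory.Transcendental.KZ.of r₃ + Literature.NumberTheory.Transcendental.KZ.of r₄ ∈ Literature.NumberTheory.Transcendental.KZ.relations

namespace A

/-- `r₄ = [band, H V'/V] = [[1,0], 0]` (empty band). -/
def r₄ : KZ.IntegralRep 1 := zeroRep (I 1 0) sa_I10
/-- `r₁ = [{1 ≤ u ≤ V} over the empty band, 0]`. -/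
def r₁ : KZ.IntegralRep 2 := r1zero (I 1 0) sa_I10 (fun _ => 2) (sa_two sa_I10)
/-- The constant `V = 2` at the endpoints. [folklore] -/
theorem hv (c : ℝ) : ∀ x : Fin 0 → ℝ, (fun _ : Fin 1 → ℝ => (2 : ℝ)) (Fin.snoc x c) = 2 := fun _ => rfl
/-- `r₂ = [{1 ≤ u ≤ V(b)}, H(b)/u] = [[1,2], 0]`. -/
def r₂ : KZ.IntegralRep 1 := zeroRep (Bdry (fun _ => 2) 0) (sa_Bdry (hv 0) (sa_two sa_τ₀))
/-- `r₃ = [{1 ≤ u ≤ V(a)}, H(a)/u] = [[1,2], 1/u]`, value `log 2`. -/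
def r₃ : KZ.IntegralRep 1 :=
  invRep (Bdry (fun _ => 2) 1) (sa_Bdry (hv 1) (sa_two sa_τ₀)) (Bdry_subset_I12 (hv 1) le_rfl)

end A

/-- **`a ≤ b` is load-bearing**: without it the crux is false (witness A). Any proof must use `hab`
(it is what makes the empty-fibre case consistent: for `b < a` the band is empty but the boundary
terms `H(a) log V(a)`, `H(b) log V(b)` need not cancel — the same soundness caveat as printed for
`KZ.newtonLeibnizRel`). -/
theorem unfoldedLogStokes_false_without_hab : ¬ WithoutHab := by
  intro h
  have hcont : ∀ x ∈ τ₀, ContinuousOn (fun t : ℝ => Hcoord (Fin.snoc x t)) (Icc 1 0) ∧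
      ContinuousOn (fun _ : ℝ => (2 : ℝ)) (Icc 1 0) := fun x _ =>
    ⟨by simp only [Hcoord_apply, snoc_fin0]; exact continuousOn_id, continuousOn_const⟩
  have hder : ∀ x ∈ τ₀, ∀ t ∈ Ioo (1 : ℝ) 0,
      HasDerivAt (fun s : ℝ => Hcoord (Fin.snoc x s)) 1 t ∧ HasDerivAt (fun _ : ℝ => (2 : ℝ)) 0 t :=
    fun x _ t _ => ⟨by simp only [Hcoord_apply, snoc_fin0]; exact hasDerivAt_id' t,
      hasDerivAt_const t 2⟩
  have hr₄ : ∀ z ∈ A.r₄.domain, (1 : ℝ) < z 0 → z 0 < 0 →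
      A.r₄.integrand z = Hcoord z * 0 / 2 := fun z _ _ _ => by simp [A.r₄]
  have hr₁ : ∀ w ∈ A.r₁.domain, (1 : ℝ) < Fin.init w 0 → Fin.init w 0 < 0 →
      A.r₁.integrand w = 1 / w (Fin.last 1) := fun w _ h1 h2 =>
    absurd (h1.trans h2) (by norm_num)
  have hr₂ : ∀ z ∈ A.r₂.domain,
      A.r₂.integrand z = Hcoord (Fin.snoc (Fin.init z) 0) / z 0 := fun z _ => by
    simp [A.r₂]
  have hr₃ : ∀ z ∈ A.r₃.domain,
      A.r₃.integrand z = Hcoord (Fin.snoc (Fin.init z) 1) / z 0 := fun z _ => by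
    simp [A.r₃]
  have key := h 0 τ₀ (fun _ => 1) (fun _ => 0) Hcoord (fun _ => 1) (fun _ => 2) (fun _ => 0)
    A.r₁ A.r₂ A.r₃ A.r₄ sa_τ₀ (sa_one sa_τ₀) (sa_zero sa_τ₀) rfl (sa_Hcoord sa_I10) (sa_two sa_I10)
    (fun z _ => by norm_num) hcont hder hr₄ rfl hr₁ rfl hr₂ rfl hr₃
  have hval := values_of_mem_relations _ _ _ _ key
  have h3 : 1 / 2 ≤ A.r₃.value := half_le_value_invRep _ _ (Bdry_eq_I (A.hv 1))
  simp only [A.r₁, A.r₂, A.r₄, r1zero, value_zeroRep] at hval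
  linarith

/-! ### §2b `1 ≤ V` is load-bearing (it cannot be weakened to `0 < V`)
Witness B: `n = 0`, `[a,b] = [0,1]`, `H = 1`, `H' = 0`, `V = (1+t)/2 ∈ [1/2, 1]`, `V' = 1/2`.  The
unfolded fibres `{1 ≤ u ≤ V}` are EMPTY (or a point), so `r₁, r₂, r₃` vanish, but the bulk term
`r₄ = [[0,1], V'/V] = [[0,1], 1/(1+t)]` has value `log 2 > 0`.  Mechanism: for `V < 1` the unfolding
`log V = ∫₁^V du/u` needs the ORIENTED interval; the honest domain `{1 ≤ u ≤ V}` silently computes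
`log⁺ V` instead.  (The crux's own docstring handles `0 < V` by `log v = log max(v,1) − log max(1/v,1)`
upstream, in `LogPrimitiveNL`; the engine itself needs `1 ≤ V`.) -/

/-- The crux with `∀ z ∈ r₄.domain, 1 ≤ V z` WEAKENED to `∀ z ∈ r₄.domain, 0 < V z`. -/
def PosV : Prop :=
  ∀ (n : ℕ) (τ : Set (Fin n → ℝ)) (a b : (Fin n → ℝ) → ℝ) (H H' V V' : (Fin (n + 1) → ℝ) → ℝ) (r₁ : Literature.NumberTheory.Transcendental.KZ.IntegralRep (n + 2)) (r₂ r₃ r₄ : Literature.NumberTheory.Transcendental.KZ.IntegralRep (n + 1)), Literature.ModelTheory.ExponentialFields.IsSemialgebraic ℚ τ →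
    Literature.NumberTheory.Transcendental.IsSemialgebraicFunOn ℚ τ a →
    Literature.NumberTheory.Transcendental.IsSemialgebraicFunOn ℚ τ b →
    (∀ x ∈ τ, a x ≤ b x) →
    r₄.domain = {z | (Fin.init z : Fin n → ℝ) ∈ τ ∧ a (Fin.init z) ≤ z (Fin.last n) ∧ z (Fin.last n) ≤ b (Fin.init z)} →
    Literature.NumberTheory.Transcendental.IsSemialgebraicFunOn ℚ r₄.domain H →
    Literature.NumberTheory.Transcendental.IsSemialgebraicFunOn ℚ r₄.domain V →
    (∀ z ∈ r₄.domain, 0 < V z) →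
    (∀ x ∈ τ, ContinuousOn (fun t : ℝ => H (Fin.snoc x t)) (Set.Icc (a x) (b x)) ∧ ContinuousOn (fun t : ℝ => V (Fin.snoc x t)) (Set.Icc (a x) (b x))) →
    (∀ x ∈ τ, ∀ t ∈ Set.Ioo (a x) (b x), HasDerivAt (fun s : ℝ => H (Fin.snoc x s)) (H' (Fin.snoc x t)) t ∧ HasDerivAt (fun s : ℝ => V (Fin.snoc x s)) (V' (Fin.snoc x t)) t) →
    (∀ z ∈ r₄.domain, a (Fin.init z) < z (Fin.last n) → z (Fin.last n) < b (Fin.init z) → r₄.integrand z = H z * V' z / V z) →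
    r₁.domain = {w | (Fin.init w : Fin (n + 1) → ℝ) ∈ r₄.domain ∧ 1 ≤ w (Fin.last (n + 1)) ∧ w (Fin.last (n + 1)) ≤ V (Fin.init w)} →
    (∀ w ∈ r₁.domain, a (Fin.init (Fin.init w)) < Fin.init w (Fin.last n) → Fin.init w (Fin.last n) < b (Fin.init (Fin.init w)) → r₁.integrand w = H' (Fin.init w) / w (Fin.last (n + 1))) →
    r₂.domain = {z | (Fin.init z : Fin n → ℝ) ∈ τ ∧ 1 ≤ z (Fin.last n) ∧ z (Fin.last n) ≤ V (Fin.snoc (Fin.init z) (b (Fin.init z)))} →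
    (∀ z ∈ r₂.domain, r₂.integrand z = H (Fin.snoc (Fin.init z) (b (Fin.init z))) / z (Fin.last n)) →
    r₃.domain = {z | (Fin.init z : Fin n → ℝ) ∈ τ ∧ 1 ≤ z (Fin.last n) ∧ z (Fin.last n) ≤ V (Fin.snoc (Fin.init z) (a (Fin.init z)))} →
    (∀ z ∈ r₃.domain, r₃.integrand z = H (Fin.snoc (Fin.init z) (a (Fin.init z))) / z (Fin.last n)) →
    Literature.NumberTheory.Transcendental.KZ.of r₁ - Literature.NumberTheory.Transcendental.KZ.of r₂ + Literature.NumberTheory.Transcendental.KZ.of r₃ + Literature.NumberTheory.Transcendental.KZ.of r₄ ∈ Literature.NumberTheory.Transcendental.KZ.relations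

namespace B

/-- `r₄ = [[0,1], H V'/V] = [[0,1], 1/(1+t)]`, value `log 2`. -/
def r₄ : KZ.IntegralRep 1 := r4inv
/-- `r₁ = [{1 ≤ u ≤ (1+t)/2}, H'/u = 0]` (null domain anyway). -/
def r₁ : KZ.IntegralRep 2 := r1zero (I 0 1) sa_I01 Vhalf (sa_Vhalf sa_I01)
/-- `r₂ = [{1 ≤ u ≤ V(1) = 1}, 1/u]` (null). -/
def r₂ : KZ.IntegralRep 1 :=
  invRep (Bdry Vhalf 1) (sa_Bdry Vhalf_snoc_one (sa_one sa_τ₀)) (Bdry_subset_I12 Vhalf_snoc_one one_le_two)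
/-- `r₃ = [{1 ≤ u ≤ V(0) = 1/2}, 1/u]` (empty). -/
def r₃ : KZ.IntegralRep 1 :=
  invRep (Bdry Vhalf 0) (sa_Bdry Vhalf_snoc_zero sa_half)
    (Bdry_subset_I12 Vhalf_snoc_zero (by norm_num))

/-- This boundary representation has null domain, value `0`. [folklore] -/
theorem value_r₂ : r₂.value = 0 :=
  value_invRep_of_null _ _ (by rw [Bdry_eq_I Vhalf_snoc_one]; exact volume_I_eq_zero le_rfl)
/-- This boundary representation has null domain, value `0`. [folklore] -/
theorem value_r₃ : r₃.value = 0 :=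
  value_invRep_of_null _ _ (by rw [Bdry_eq_I Vhalf_snoc_zero]; exact volume_I_eq_zero (by norm_num))

end B

/-- **`1 ≤ V` is load-bearing** (and sharp as a hypothesis of the ENGINE): with `0 < V` only, the
crux is false (witness B). -/
theorem not_posV : ¬ PosV := by
  intro h
  have hVpos : ∀ z ∈ B.r₄.domain, 0 < Vhalf z := fun z hz => by
    have h1 := (mem_I.1 hz).1
    simp only [Vhalf_apply]
    linarith
  have hcont : ∀ x ∈ τ₀, ContinuousOn (fun _ : ℝ => (1 : ℝ)) (Icc 0 1) ∧
      ContinuousOn (fun t : ℝ => Vhalf (Fin.snoc x t)) (Icc 0 1) := fun x _ =>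
    ⟨continuousOn_const, continuousOn_Vhalf x _⟩
  have hder : ∀ x ∈ τ₀, ∀ t ∈ Ioo (0 : ℝ) 1,
      HasDerivAt (fun _ : ℝ => (1 : ℝ)) 0 t ∧
        HasDerivAt (fun s : ℝ => Vhalf (Fin.snoc x s)) (1 / 2) t := fun x _ t _ =>
    ⟨hasDerivAt_const t 1, hasDerivAt_Vhalf t x⟩
  have hr₄ : ∀ z ∈ B.r₄.domain, (0 : ℝ) < z 0 → z 0 < 1 →
      B.r₄.integrand z = 1 * (1 / 2) / Vhalf z := fun z hz _ _ => by
    have h1 := (mem_I.1 hz).1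
    have h2 : (1 + z 0) ≠ 0 := ne_of_gt (by linarith)
    simp only [B.r₄, r4inv_integrand, Vhalf_apply]
    field_simp
  have hr₁ : ∀ w ∈ B.r₁.domain, (0 : ℝ) < Fin.init w 0 → Fin.init w 0 < 1 →
      B.r₁.integrand w = 0 / w (Fin.last 1) := fun w _ _ _ => by simp [B.r₁, r1zero]
  have hr₂ : ∀ z ∈ B.r₂.domain, B.r₂.integrand z = 1 / z 0 := fun z _ => by simp [B.r₂]
  have hr₃ : ∀ z ∈ B.r₃.domain, B.r₃.integrand z = 1 / z 0 := fun z _ => by simp [B.r₃]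
  have key := h 0 τ₀ (fun _ => 0) (fun _ => 1) (fun _ => 1) (fun _ => 0) Vhalf (fun _ => 1 / 2)
    B.r₁ B.r₂ B.r₃ B.r₄ sa_τ₀ (sa_zero sa_τ₀) (sa_one sa_τ₀) (fun _ _ => zero_le_one) rfl
    (sa_one sa_I01) (sa_Vhalf sa_I01) hVpos hcont hder hr₄ rfl hr₁ rfl hr₂ rfl hr₃
  have hval := values_of_mem_relations _ _ _ _ key
  have h4 : 1 / 2 ≤ B.r₄.value := half_le_value_r4inv
  rw [B.value_r₂, B.value_r₃] at hval
  simp only [B.r₁, r1zero, value_zeroRep] at hval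
  linarith

/-! ### §2c continuity of `V` on the CLOSED fibre is load-bearing
Witness C: `[a,b] = [0,1]`, `H = 1`, `H' = 0`, `V = 1` on `[0,1)`, `V(1) = 2` (semialgebraic step,
differentiable with `V' = 0` on the open fibre), so `r₁ = r₃ = r₄ = 0` but
`r₂ = [{1 ≤ u ≤ V(1)}, 1/u] = log 2`.  Mechanism: the boundary term reads the endpoint VALUE
`V(x, b x)`, the bulk reads the interior; only continuity ties them. -/

/-- The crux with the continuity of `t ↦ V (x,t)` on `[a x, b x]` DELETED (continuity of `H` kept). -/
def WithoutContV : Prop :=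
  ∀ (n : ℕ) (τ : Set (Fin n → ℝ)) (a b : (Fin n → ℝ) → ℝ) (H H' V V' : (Fin (n + 1) → ℝ) → ℝ) (r₁ : Literature.NumberTheory.Transcendental.KZ.IntegralRep (n + 2)) (r₂ r₃ r₄ : Literature.NumberTheory.Transcendental.KZ.IntegralRep (n + 1)), Literature.ModelTheory.ExponentialFields.IsSemialgebraic ℚ τ →
    Literature.NumberTheory.Transcendental.IsSemialgebraicFunOn ℚ τ a →
    Literature.NumberTheory.Transcendental.IsSemialgebraicFunOn ℚ τ b →
    (∀ x ∈ τ, a x ≤ b x) →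
    r₄.domain = {z | (Fin.init z : Fin n → ℝ) ∈ τ ∧ a (Fin.init z) ≤ z (Fin.last n) ∧ z (Fin.last n) ≤ b (Fin.init z)} →
    Literature.NumberTheory.Transcendental.IsSemialgebraicFunOn ℚ r₄.domain H →
    Literature.NumberTheory.Transcendental.IsSemialgebraicFunOn ℚ r₄.domain V →
    (∀ z ∈ r₄.domain, 1 ≤ V z) →
    (∀ x ∈ τ, ContinuousOn (fun t : ℝ => H (Fin.snoc x t)) (Set.Icc (a x) (b x))) →
    (∀ x ∈ τ, ∀ t ∈ Set.Ioo (a x) (b x), HasDerivAt (fun s : ℝ => H (Fin.snoc x s)) (H' (Fin.snoc x t)) t ∧ HasDerivAt (fun s : ℝ => V (Fin.snoc x s)) (V' (Fin.snoc x t)) t) →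
    (∀ z ∈ r₄.domain, a (Fin.init z) < z (Fin.last n) → z (Fin.last n) < b (Fin.init z) → r₄.integrand z = H z * V' z / V z) →
    r₁.domain = {w | (Fin.init w : Fin (n + 1) → ℝ) ∈ r₄.domain ∧ 1 ≤ w (Fin.last (n + 1)) ∧ w (Fin.last (n + 1)) ≤ V (Fin.init w)} →
    (∀ w ∈ r₁.domain, a (Fin.init (Fin.init w)) < Fin.init w (Fin.last n) → Fin.init w (Fin.last n) < b (Fin.init (Fin.init w)) → r₁.integrand w = H' (Fin.init w) / w (Fin.last (n + 1))) →
    r₂.domain = {z | (Fin.init z : Fin n → ℝ) ∈ τ ∧ 1 ≤ z (Fin.last n) ∧ z (Fin.last n) ≤ V (Fin.snoc (Fin.init z) (b (Fin.init z)))} →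
    (∀ z ∈ r₂.domain, r₂.integrand z = H (Fin.snoc (Fin.init z) (b (Fin.init z))) / z (Fin.last n)) →
    r₃.domain = {z | (Fin.init z : Fin n → ℝ) ∈ τ ∧ 1 ≤ z (Fin.last n) ∧ z (Fin.last n) ≤ V (Fin.snoc (Fin.init z) (a (Fin.init z)))} →
    (∀ z ∈ r₃.domain, r₃.integrand z = H (Fin.snoc (Fin.init z) (a (Fin.init z))) / z (Fin.last n)) →
    Literature.NumberTheory.Transcendental.KZ.of r₁ - Literature.NumberTheory.Transcendental.KZ.of r₂ + Literature.NumberTheory.Transcendental.KZ.of r₃ + Literature.NumberTheory.Transcendental.KZ.of r₄ ∈ Literature.NumberTheory.Transcendental.KZ.relations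

namespace C

/-- The representation `r₄ = [band, H V'/V]` of this witness (honest). [folklore] -/
def r₄ : KZ.IntegralRep 1 := zeroRep (I 0 1) sa_I01
/-- The representation `r₁ = [{1 ≤ u ≤ V}, H'/u]` of this witness (honest). [folklore] -/
def r₁ : KZ.IntegralRep 2 := r1zero (I 0 1) sa_I01 (step 1 2) (sa_step (sa_one sa_I01) (sa_two sa_I01))
/-- `r₂ = [{1 ≤ u ≤ V(1) = 2}, 1/u]`, value `log 2`. -/
def r₂ : KZ.IntegralRep 1 :=
  invRep (Bdry (step 1 2) 1) (sa_Bdry (step_snoc_one 1 2) (sa_two sa_τ₀))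
    (Bdry_subset_I12 (step_snoc_one 1 2) le_rfl)
/-- `r₃ = [{1 ≤ u ≤ V(0) = 1}, 1/u]` (null). -/
def r₃ : KZ.IntegralRep 1 :=
  invRep (Bdry (step 1 2) 0) (sa_Bdry (step_snoc_zero 1 2) (sa_one sa_τ₀))
    (Bdry_subset_I12 (step_snoc_zero 1 2) one_le_two)

/-- This boundary representation has null domain, value `0`. [folklore] -/
theorem value_r₃ : r₃.value = 0 :=
  value_invRep_of_null _ _ (by rw [Bdry_eq_I (step_snoc_zero 1 2)]; exact volume_I_eq_zero le_rfl)

end C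

/-- **Continuity of `V` up to the fibre boundary is load-bearing** (witness C). -/
theorem unfoldedLogStokes_false_without_contV : ¬ WithoutContV := by
  intro h
  have hV1 : ∀ z ∈ C.r₄.domain, 1 ≤ step 1 2 z := fun z _ => by
    unfold step; split_ifs <;> norm_num
  have hcont : ∀ x ∈ τ₀, ContinuousOn (fun _ : ℝ => (1 : ℝ)) (Icc 0 1) := fun _ _ =>
    continuousOn_const
  have hder : ∀ x ∈ τ₀, ∀ t ∈ Ioo (0 : ℝ) 1,
      HasDerivAt (fun _ : ℝ => (1 : ℝ)) 0 t ∧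
        HasDerivAt (fun s : ℝ => step 1 2 (Fin.snoc x s)) 0 t := fun x _ t ht =>
    ⟨hasDerivAt_const t 1, hasDerivAt_step 1 2 ht.2 x⟩
  have hr₄ : ∀ z ∈ C.r₄.domain, (0 : ℝ) < z 0 → z 0 < 1 →
      C.r₄.integrand z = 1 * 0 / step 1 2 z := fun z _ _ _ => by simp [C.r₄]
  have hr₁ : ∀ w ∈ C.r₁.domain, (0 : ℝ) < Fin.init w 0 → Fin.init w 0 < 1 →
      C.r₁.integrand w = 0 / w (Fin.last 1) := fun w _ _ _ => by simp [C.r₁, r1zero]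
  have hr₂ : ∀ z ∈ C.r₂.domain, C.r₂.integrand z = 1 / z 0 := fun z _ => by simp [C.r₂]
  have hr₃ : ∀ z ∈ C.r₃.domain, C.r₃.integrand z = 1 / z 0 := fun z _ => by simp [C.r₃]
  have key := h 0 τ₀ (fun _ => 0) (fun _ => 1) (fun _ => 1) (fun _ => 0) (step 1 2) (fun _ => 0)
    C.r₁ C.r₂ C.r₃ C.r₄ sa_τ₀ (sa_zero sa_τ₀) (sa_one sa_τ₀) (fun _ _ => zero_le_one) rfl
    (sa_one sa_I01) (sa_step (sa_one sa_I01) (sa_two sa_I01)) hV1 hcont hder hr₄ rfl hr₁ rfl hr₂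
    rfl hr₃
  have hval := values_of_mem_relations _ _ _ _ key
  have h2 : 1 / 2 ≤ C.r₂.value := half_le_value_invRep _ _ (Bdry_eq_I (step_snoc_one 1 2))
  rw [C.value_r₃] at hval
  simp only [C.r₁, C.r₄, r1zero, value_zeroRep] at hval
  linarith


end Summit.KontsevichZagierPeriods.LiouvilleUnfolding.UnfoldedLogStokesNegative
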